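/-
Origin: expansion seat `planner-pub-hodgecm-toy-g2-0`, handover #12 2026-08-18T07:35:41Z (`HOME/pub-hodgecm-toy-g2/lean/ToyG2/Blocks.lean`, md5 8f77336c, 477 lines);
landed by the gen-7 packager in gate run 26 as `HodgeCM/Model/ToyG2/Blocks.lean` (import ^import ToyG2\.→import HodgeCM.Model.ToyG2. ×1).
-/
/-
Copyright (c) 2026. All rights reserved.
Released under Apache 2.0 license as described in the file LICENSE.
-/
import Mathlib
import Summits.HodgeConjecture.HodgeCM.Model.ToyG2.Objects2
import Summits.HodgeConjecture.HodgeCM.Model.Toy.Duality_4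

/-!
# ToyG2.Blocks — the period functional `ℓ_Θ` of one block `M_Θ = A_{Θ₀} × A_{Θ₁} × A_{Θ₂} × A_{Θ₃}`

DESIGN.md §3.  For a CM field `L`, a quadruple of CM types `Θ : Fin 4 → CMType L` and a *Riemann
system* `ξ : Fin 4 → L` (`ToyG2.RiemannSystem.exists_riemannSystem`: `ξ̄ᵢ = -ξᵢ`, `Im θ(ξᵢ) > 0 ↔ θ ∈ Θᵢ`,
`ξ₀ξ₁ = ξ₂ξ₃`), the block is the generation-1 object `PP L Θ` (`H¹ = F_L⁴`, slot `i` of CM type `Θᵢ`), and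
its period functional on `⋀⁴ H¹` is

  `ℓ = E₀∧E₁ + E₂∧E₃ + d · (E₀∧E₂ + E₀∧E₃ + E₁∧E₂ + E₁∧E₃) + t · T`,

where `Eᵢ(u, u') = Tr_{F_L/ℚ}(ξᵢ u ū') - Tr(ξᵢ u' ū)` is (twice) the Riemann form of slot `i`,
`Eₐ∧E_b` is the exterior product of the two pulled-back 2-forms (`AlternatingMap.domCoprod`), and `T` is the
alternatization of the quadrilinear twist `v ↦ Tr(ξ₂ξ₃ · v₀⁽⁰⁾ v₁⁽¹⁾ v̄₂⁽²⁾ v̄₃⁽³⁾)` (`v⁽ⁱ⁾` = slot-`i` component).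
Everything is rational and parametric in `(ξ, d, t)`; the sign/positivity analysis (BlockGram) fixes
`d = 2`, `t = ±1` downstream.

Main results (all kernel-checked, Mathlib + generation 1 only):
* `domCoprod_eq_zero_of_card_lt` / `…'`: a `domCoprod` of pulled-back forms vanishes on a family in which
  fewer than `#ιa` (resp. `#ιb`) members survive the first (resp. second) pull-back (pigeonhole on shuffles);
* `EE_apply_pair`: `(Eₐ∧E_b)(x, x', y, y') = Eₐ(x,x') · E_b(y,y')` on a family sitting in slots `a,a,b,b`;
* `TT_apply_sorted`: `T(x₀,x₁,x₂,x₃) = Tr(ξ₂ξ₃ x₀x₁x̄₂x̄₃)` on a family sitting in slots `0,1,2,3`, and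
  `TT_eq_zero_of_slot_missing`;
* `ell_apply_pair`, `ell_apply_sorted`: the values of `ℓ` on the two kinds of block families;
* `E2_antisymm_apply`, `E2_one`: `Eᵢ(1, ξᵢ⁻¹‾) = 2 [L:ℚ]`, whence **`ellLin_ne_zero`**: `ℓ ≠ 0`;
* `pLeaf L Θ ξ d t : PLeaf` — the period block fed to `toyModel2With` (`ToyG2.Universe2`), with
  `trace4 = ℓ` (`ToyG2.Trace.trOf_pbObj`).
-/

namespace HodgeCM.ToyG2

open HodgeCM.Toy HodgeCM.Toy.CMPresentation
open scoped TensorProduct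
open exteriorPower Obj₂
open Literature.AlgebraicGeometry.Motives
open Literature.AlgebraicGeometry.ShimuraVarieties (conjRingHomK)

noncomputable section

/-! ### §0 Generic vanishing lemmas for `domCoprod` and `alternatization` -/

section Generic

variable {ιa ιb : Type*} [Fintype ιa] [Fintype ιb] [DecidableEq ιa] [DecidableEq ιb]
  {R : Type*} [CommRing R] {M P Q N₁ N₂ : Type*}
  [AddCommGroup M] [Module R M] [AddCommGroup P] [Module R P] [AddCommGroup Q] [Module R Q]
  [AddCommGroup N₁] [Module R N₁] [AddCommGroup N₂] [Module R N₂]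

/-- Pigeonhole on shuffles: if fewer than `#ιa` members of the family survive the first pull-back `f`,
every shuffle summand of `domCoprod` has a vanishing first factor. -/
theorem domCoprod_eq_zero_of_card_lt (α : P [⋀^ιa]→ₗ[R] N₁) (β : Q [⋀^ιb]→ₗ[R] N₂)
    (f : M →ₗ[R] P) (g : M →ₗ[R] Q) (v : ιa ⊕ ιb → M) (S : Finset (ιa ⊕ ιb))
    (hS : S.card < Fintype.card ιa) (hf : ∀ k, k ∉ S → f (v k) = 0) :
    (α.compLinearMap f).domCoprod (β.compLinearMap g) v = 0 := by
  change (⇑(∑ σ : Equiv.Perm.ModSumCongr ιa ιb,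
    AlternatingMap.domCoprod.summand (α.compLinearMap f) (β.compLinearMap g) σ)) v = _
  rw [_root_.sum_apply]
  refine Finset.sum_eq_zero fun σ _ => ?_
  induction σ using Quotient.inductionOn' with
  | h σ =>
    rw [AlternatingMap.domCoprod.summand_mk'', _root_.smul_apply,
      MultilinearMap.domDomCongr_apply, MultilinearMap.domCoprod_apply]
    have hex : ∃ i, σ (Sum.inl i) ∉ S := by
      by_contra hne
      push Not at hne
      have hinj : Function.Injective (fun i : ιa => (⟨σ (Sum.inl i), hne i⟩ : S)) := by
        intro i j h
        simpa using congrArg Subtype.val h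
      have := Fintype.card_le_of_injective _ hinj
      rw [Fintype.card_coe] at this
      omega
    obtain ⟨i, hi⟩ := hex
    have hz : (↑(α.compLinearMap f) : MultilinearMap R (fun _ : ιa => M) N₁)
        (fun i' => v (σ (Sum.inl i'))) = 0 := by
      rw [AlternatingMap.coe_multilinearMap, AlternatingMap.compLinearMap_apply]
      exact α.map_coord_zero i (by simp [hf _ hi])
    rw [hz, TensorProduct.zero_tmul, smul_zero]

/-- The same with the rôles of the two factors exchanged. -/
theorem domCoprod_eq_zero_of_card_lt' (α : P [⋀^ιa]→ₗ[R] N₁) (β : Q [⋀^ιb]→ₗ[R] N₂)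
    (f : M →ₗ[R] P) (g : M →ₗ[R] Q) (v : ιa ⊕ ιb → M) (S : Finset (ιa ⊕ ιb))
    (hS : S.card < Fintype.card ιb) (hg : ∀ k, k ∉ S → g (v k) = 0) :
    (α.compLinearMap f).domCoprod (β.compLinearMap g) v = 0 := by
  change (⇑(∑ σ : Equiv.Perm.ModSumCongr ιa ιb,
    AlternatingMap.domCoprod.summand (α.compLinearMap f) (β.compLinearMap g) σ)) v = _
  rw [_root_.sum_apply]
  refine Finset.sum_eq_zero fun σ _ => ?_
  induction σ using Quotient.inductionOn' with
  | h σ =>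
    rw [AlternatingMap.domCoprod.summand_mk'', _root_.smul_apply,
      MultilinearMap.domDomCongr_apply, MultilinearMap.domCoprod_apply]
    have hex : ∃ j, σ (Sum.inr j) ∉ S := by
      by_contra hne
      push Not at hne
      have hinj : Function.Injective (fun j : ιb => (⟨σ (Sum.inr j), hne j⟩ : S)) := by
        intro i j h
        simpa using congrArg Subtype.val h
      have := Fintype.card_le_of_injective _ hinj
      rw [Fintype.card_coe] at this
      omega
    obtain ⟨j, hj⟩ := hex
    have hz : (↑(β.compLinearMap g) : MultilinearMap R (fun _ : ιb => M) N₂)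
        (fun j' => v (σ (Sum.inr j'))) = 0 := by
      rw [AlternatingMap.coe_multilinearMap, AlternatingMap.compLinearMap_apply]
      exact β.map_coord_zero j (by simp [hg _ hj])
    rw [hz, TensorProduct.tmul_zero, smul_zero]

/-- If the first pull-back kills the second block of the family, only the trivial shuffle class
contributes (restated from `ToyG2.Trace` to keep this file independent of the trace system). -/
theorem domCoprod_apply_of_inr_eq_zero (α : P [⋀^ιa]→ₗ[R] N₁) (β : Q [⋀^ιb]→ₗ[R] N₂)
    (f : M →ₗ[R] P) (g : M →ₗ[R] Q) (v : ιa ⊕ ιb → M) (hf : ∀ j, f (v (Sum.inr j)) = 0) :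
    (α.compLinearMap f).domCoprod (β.compLinearMap g) v
      = α (fun i => f (v (Sum.inl i))) ⊗ₜ[R] β (fun j => g (v (Sum.inr j))) := by
  change (⇑(∑ σ : Equiv.Perm.ModSumCongr ιa ιb,
    AlternatingMap.domCoprod.summand (α.compLinearMap f) (β.compLinearMap g) σ)) v = _
  rw [_root_.sum_apply]
  refine (Fintype.sum_eq_single (Quotient.mk'' 1 : Equiv.Perm.ModSumCongr ιa ιb)
    (fun σ hσ => ?_)).trans ?_
  · induction σ using Quotient.inductionOn' with
    | h σ =>
      rw [AlternatingMap.domCoprod.summand_mk'', _root_.smul_apply,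
        MultilinearMap.domDomCongr_apply, MultilinearMap.domCoprod_apply]
      have hex : ∃ i j, σ (Sum.inl i) = Sum.inr j := by
        by_contra hne
        push Not at hne
        apply hσ
        have hmem : σ ∈ (Equiv.Perm.sumCongrHom ιa ιb).range := by
          apply Equiv.Perm.mem_sumCongrHom_range_of_perm_mapsTo_inl
          rintro _ ⟨i, rfl⟩
          rcases hx : σ (Sum.inl i) with i' | j
          · exact ⟨i', rfl⟩
          · exact absurd hx (hne i j)
        apply Quotient.sound'
        rw [QuotientGroup.leftRel_apply, mul_one]
        exact Subgroup.inv_mem _ hmem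
      obtain ⟨i, j, hij⟩ := hex
      have hz : (↑(α.compLinearMap f) : MultilinearMap R (fun _ : ιa => M) N₁)
          (fun i' => v (σ (Sum.inl i'))) = 0 := by
        rw [AlternatingMap.coe_multilinearMap, AlternatingMap.compLinearMap_apply]
        exact α.map_coord_zero i (by simp [hij, hf j])
      rw [hz, TensorProduct.zero_tmul, smul_zero]
  · rw [AlternatingMap.domCoprod.summand_mk'', Equiv.Perm.sign_one, one_smul,
      MultilinearMap.domDomCongr_apply, MultilinearMap.domCoprod_apply]
    rfl

variable {ι : Type*} [Fintype ι] [DecidableEq ι] {N : Type*} [AddCommGroup N] [Module R N]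

/-- An alternatization all of whose permuted evaluations but the identity vanish. -/
theorem alternatization_apply_of_ne_one (m : MultilinearMap R (fun _ : ι => M) N) (v : ι → M)
    (h : ∀ σ : Equiv.Perm ι, σ ≠ 1 → m (fun i => v (σ i)) = 0) :
    MultilinearMap.alternatization m v = m v := by
  rw [MultilinearMap.alternatization_apply]
  refine (Fintype.sum_eq_single (1 : Equiv.Perm ι) (fun σ hσ => ?_)).trans ?_
  · rw [MultilinearMap.domDomCongr_apply, h σ hσ, smul_zero]
  · rw [Equiv.Perm.sign_one, one_smul, MultilinearMap.domDomCongr_apply]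
    rfl

/-- An alternatization all of whose permuted evaluations vanish. -/
theorem alternatization_eq_zero_of_forall (m : MultilinearMap R (fun _ : ι => M) N) (v : ι → M)
    (h : ∀ σ : Equiv.Perm ι, m (fun i => v (σ i)) = 0) :
    MultilinearMap.alternatization m v = 0 := by
  rw [MultilinearMap.alternatization_apply]
  refine Finset.sum_eq_zero fun σ _ => ?_
  rw [MultilinearMap.domDomCongr_apply, h σ, smul_zero]

/-- a bilinear map as a multilinear map on `Fin 2` -/
def ofBilin (B : M →ₗ[R] M →ₗ[R] N) : MultilinearMap R (fun _ : Fin 2 => M) N where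
  toFun v := B (v 0) (v 1)
  map_update_add' v i x y := by
    fin_cases i <;> simp
  map_update_smul' v i c x := by
    fin_cases i <;> simp

/-- (Ported verbatim from the HodgeCMPerL package; no docstring in the source.) -/
@[simp] theorem ofBilin_apply (B : M →ₗ[R] M →ₗ[R] N) (v : Fin 2 → M) :
    ofBilin B v = B (v 0) (v 1) := rfl

/-- the alternating 2-form `B(u,u') - B(u',u)` of a bilinear map -/
def alt2 (B : M →ₗ[R] M →ₗ[R] N) : M [⋀^Fin 2]→ₗ[R] N := MultilinearMap.alternatization (ofBilin B)

/-- (Ported verbatim from the HodgeCMPerL package; no docstring in the source.) -/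
theorem univ_perm_fin_two : (Finset.univ : Finset (Equiv.Perm (Fin 2))) = {1, Equiv.swap 0 1} := by
  decide

/-- (Ported verbatim from the HodgeCMPerL package; no docstring in the source.) -/
theorem alt2_apply (B : M →ₗ[R] M →ₗ[R] N) (v : Fin 2 → M) :
    alt2 B v = B (v 0) (v 1) - B (v 1) (v 0) := by
  rw [alt2, MultilinearMap.alternatization_apply, univ_perm_fin_two,
    Finset.sum_pair (by decide), Equiv.Perm.sign_one, one_smul, Equiv.Perm.sign_swap (by decide),
    MultilinearMap.domDomCongr_apply, MultilinearMap.domDomCongr_apply, ofBilin_apply, ofBilin_apply,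
    Units.neg_smul, one_smul, sub_eq_add_neg]
  simp

end Generic

/-! ### §1 The block object and its four slots -/

section Block

variable (L : CMField) (Θ : Fin 4 → CMType L)

/-- the slot-`i` component `L P → F_L` -/
def pr : Fin 4 → ((PP L Θ).L →ₗ[ℚ] FK L)
  | 0 => LinearMap.proj (Sum.inl (Sum.inl (Sum.inl ())))
  | 1 => LinearMap.proj (Sum.inl (Sum.inl (Sum.inr ())))
  | 2 => LinearMap.proj (Sum.inl (Sum.inr ()))
  | 3 => LinearMap.proj (Sum.inr ())

/-- the slot-`i` inclusion `F_L → L P` -/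
def emb : Fin 4 → (FK L →ₗ[ℚ] (PP L Θ).L)
  | 0 => LinearMap.single ℚ (fun j => ((PP L Θ).atom j).F) (Sum.inl (Sum.inl (Sum.inl ())))
  | 1 => LinearMap.single ℚ (fun j => ((PP L Θ).atom j).F) (Sum.inl (Sum.inl (Sum.inr ())))
  | 2 => LinearMap.single ℚ (fun j => ((PP L Θ).atom j).F) (Sum.inl (Sum.inr ()))
  | 3 => LinearMap.single ℚ (fun j => ((PP L Θ).atom j).F) (Sum.inr ())

/-- (Ported verbatim from the HodgeCMPerL package; no docstring in the source.) -/
@[simp] theorem pr_emb_self (i : Fin 4) (u : FK L) : pr L Θ i (emb L Θ i u) = u := by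
  fin_cases i <;> rfl

/-- (Ported verbatim from the HodgeCMPerL package; no docstring in the source.) -/
theorem pr_emb_of_ne {i j : Fin 4} (h : i ≠ j) (u : FK L) : pr L Θ j (emb L Θ i u) = 0 := by
  fin_cases i <;> fin_cases j <;> first | exact absurd rfl h | rfl

/-- bookkeeping: a family on `Fin 4` read through `finSumFinEquiv : Fin 2 ⊕ Fin 2 ≃ Fin 4` -/
@[simp] theorem vec4_finSumFinEquiv_inl_zero {α : Type*} (a b c e : α) :
    ![a, b, c, e] (finSumFinEquiv (m := 2) (n := 2) (Sum.inl 0)) = a := rfl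
/-- (Ported verbatim from the HodgeCMPerL package; no docstring in the source.) -/
@[simp] theorem vec4_finSumFinEquiv_inl_one {α : Type*} (a b c e : α) :
    ![a, b, c, e] (finSumFinEquiv (m := 2) (n := 2) (Sum.inl 1)) = b := rfl
/-- (Ported verbatim from the HodgeCMPerL package; no docstring in the source.) -/
@[simp] theorem vec4_finSumFinEquiv_inr_zero {α : Type*} (a b c e : α) :
    ![a, b, c, e] (finSumFinEquiv (m := 2) (n := 2) (Sum.inr 0)) = c := rfl
/-- (Ported verbatim from the HodgeCMPerL package; no docstring in the source.) -/
@[simp] theorem vec4_finSumFinEquiv_inr_one {α : Type*} (a b c e : α) :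
    ![a, b, c, e] (finSumFinEquiv (m := 2) (n := 2) (Sum.inr 1)) = e := rfl

/-! ### §2 The forms -/

variable (ξ : Fin 4 → L)

/-- complex conjugation of `F_L` as a `ℚ`-linear map -/
def cFl : FK L →ₗ[ℚ] FK L := (cF L).toRatAlgHom.toLinearMap

/-- (Ported verbatim from the HodgeCMPerL package; no docstring in the source.) -/
@[simp] theorem cFl_apply (u : FK L) : cFl L u = cF L u := rfl

/-- the twisted trace form `(u, u') ↦ Tr(η u ū')` on `F_L` -/
def bil (η : FK L) : FK L →ₗ[ℚ] FK L →ₗ[ℚ] ℚ :=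
  (Algebra.traceForm ℚ (FK L)).compl₁₂ (LinearMap.mulLeft ℚ η) (cFl L)

/-- (Ported verbatim from the HodgeCMPerL package; no docstring in the source.) -/
@[simp] theorem bil_apply (η u w : FK L) : bil L η u w = Algebra.trace ℚ (FK L) (η * u * cF L w) := by
  simp [bil, Algebra.traceForm_apply]

/-- `Eᵢ(u,u') = Tr(ξᵢ u ū') - Tr(ξᵢ u' ū)` (twice the Riemann form of slot `i`), a 2-form on `F_L` -/
def E2 (i : Fin 4) : FK L [⋀^Fin 2]→ₗ[ℚ] ℚ := alt2 (bil L (eK L (ξ i)))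

/-- (Ported verbatim from the HodgeCMPerL package; no docstring in the source.) -/
theorem E2_apply (i : Fin 4) (v : Fin 2 → FK L) :
    E2 L ξ i v = Algebra.trace ℚ (FK L) (eK L (ξ i) * v 0 * cF L (v 1))
      - Algebra.trace ℚ (FK L) (eK L (ξ i) * v 1 * cF L (v 0)) := by
  simp [E2, alt2_apply]

/-- `Eₐ ∧ E_b`, the exterior product of the slot-`a` and slot-`b` pull-backs, a 4-form on `L P` -/
def EE (a b : Fin 4) : (PP L Θ).L [⋀^Fin 4]→ₗ[ℚ] ℚ :=
  ((TensorProduct.lid ℚ ℚ).toLinearMap.compAlternatingMap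
    (((E2 L ξ a).compLinearMap (pr L Θ a)).domCoprod ((E2 L ξ b).compLinearMap (pr L Θ b)))).domDomCongr
    finSumFinEquiv

/-- the four linear legs of the twist: `ξ₂ξ₃ · pr₀`, `pr₁`, `c ∘ pr₂`, `c ∘ pr₃` -/
def leg : Fin 4 → ((PP L Θ).L →ₗ[ℚ] FK L)
  | 0 => LinearMap.mulLeft ℚ (eK L (ξ 2 * ξ 3)) ∘ₗ pr L Θ 0
  | 1 => pr L Θ 1
  | 2 => cFl L ∘ₗ pr L Θ 2
  | 3 => cFl L ∘ₗ pr L Θ 3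

/-- the quadrilinear twist `v ↦ Tr(ξ₂ξ₃ · v₀⁽⁰⁾ v₁⁽¹⁾ v̄₂⁽²⁾ v̄₃⁽³⁾)` -/
def Tm : MultilinearMap ℚ (fun _ : Fin 4 => (PP L Θ).L) ℚ :=
  (Algebra.trace ℚ (FK L)).compMultilinearMap
    ((MultilinearMap.mkPiAlgebra ℚ (Fin 4) (FK L)).compLinearMap fun k => leg L Θ ξ k)

/-- (Ported verbatim from the HodgeCMPerL package; no docstring in the source.) -/
theorem Tm_apply (v : Fin 4 → (PP L Θ).L) :
    Tm L Θ ξ v = Algebra.trace ℚ (FK L) (∏ k, leg L Θ ξ k (v k)) := by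
  simp [Tm, MultilinearMap.mkPiAlgebra_apply]

/-- its alternatization `T`, a 4-form on `L P` -/
def TT : (PP L Θ).L [⋀^Fin 4]→ₗ[ℚ] ℚ := MultilinearMap.alternatization (Tm L Θ ξ)

variable (d t : ℚ)

/-- **the period form of the block**
`ℓ = E₀∧E₁ + E₂∧E₃ + d (E₀∧E₂ + E₀∧E₃ + E₁∧E₂ + E₁∧E₃) + t T` -/
def ell : (PP L Θ).L [⋀^Fin 4]→ₗ[ℚ] ℚ :=
  EE L Θ ξ 0 1 + EE L Θ ξ 2 3
    + d • (EE L Θ ξ 0 2 + EE L Θ ξ 0 3 + EE L Θ ξ 1 2 + EE L Θ ξ 1 3) + t • TT L Θ ξ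

/-- … as a functional on `⋀⁴ H¹` -/
def ellLin : (⋀[ℚ]^4 (PP L Θ).L) →ₗ[ℚ] ℚ := alternatingMapLinearEquiv (ell L Θ ξ d t)

/-- (Ported verbatim from the HodgeCMPerL package; no docstring in the source.) -/
@[simp] theorem ellLin_apply_ιMulti (v : Fin 4 → (PP L Θ).L) :
    ellLin L Θ ξ d t (ιMulti ℚ 4 v) = ell L Θ ξ d t v := by
  simp [ellLin]

/-- **the period block** `(M_Θ, ℓ)` of the generation-2 universe -/
def pLeaf : PLeaf := ⟨PP L Θ, ellLin L Θ ξ d t⟩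

/-- (Ported verbatim from the HodgeCMPerL package; no docstring in the source.) -/
@[simp] theorem pLeaf_O : (pLeaf L Θ ξ d t).O = PP L Θ := rfl
/-- (Ported verbatim from the HodgeCMPerL package; no docstring in the source.) -/
@[simp] theorem pLeaf_ℓ : (pLeaf L Θ ξ d t).ℓ = ellLin L Θ ξ d t := rfl

/-- the coefficient of `Eₐ∧E_b` in `ℓ` -/
def ellCoef (a b : Fin 4) : ℚ := if (a = 0 ∧ b = 1) ∨ (a = 2 ∧ b = 3) then 1 else d

/-! ### §3 Values on block families -/

/-- `Eₐ∧E_b` on a family in slots `a, a, b, b` (`a ≠ b`) is the product of the two 2-forms. -/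
theorem EE_apply_pair {a b : Fin 4} (hab : a ≠ b) (u u' w w' : FK L) :
    EE L Θ ξ a b ![emb L Θ a u, emb L Θ a u', emb L Θ b w, emb L Θ b w']
      = E2 L ξ a ![u, u'] * E2 L ξ b ![w, w'] := by
  rw [EE, AlternatingMap.domDomCongr_apply, LinearMap.compAlternatingMap_apply,
    domCoprod_apply_of_inr_eq_zero]
  · rw [LinearEquiv.coe_coe, TensorProduct.lid_tmul, smul_eq_mul]
    congr 1
    · congr 1; funext i; fin_cases i <;> simp [Function.comp_apply]
    · congr 1; funext j; fin_cases j <;> simp [Function.comp_apply]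
  · intro j; fin_cases j <;> simp [Function.comp_apply, pr_emb_of_ne L Θ hab.symm]

/-- `Eₐ∧E_b` vanishes on a family of which fewer than two members have a slot-`a` component … -/
theorem EE_eq_zero_left (a b : Fin 4) (v : Fin 4 → (PP L Θ).L) (S : Finset (Fin 4)) (hS : S.card < 2)
    (h : ∀ k, k ∉ S → pr L Θ a (v k) = 0) : EE L Θ ξ a b v = 0 := by
  rw [EE, AlternatingMap.domDomCongr_apply, LinearMap.compAlternatingMap_apply,
    domCoprod_eq_zero_of_card_lt _ _ _ _ _ (S.map finSumFinEquiv.symm.toEmbedding) (by simpa using hS),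
    map_zero]
  intro k hk
  apply h
  intro hk'
  apply hk
  rw [Finset.mem_map]
  exact ⟨_, hk', by simp⟩

/-- … or fewer than two members with a slot-`b` component. -/
theorem EE_eq_zero_right (a b : Fin 4) (v : Fin 4 → (PP L Θ).L) (S : Finset (Fin 4)) (hS : S.card < 2)
    (h : ∀ k, k ∉ S → pr L Θ b (v k) = 0) : EE L Θ ξ a b v = 0 := by
  rw [EE, AlternatingMap.domDomCongr_apply, LinearMap.compAlternatingMap_apply,
    domCoprod_eq_zero_of_card_lt' _ _ _ _ _ (S.map finSumFinEquiv.symm.toEmbedding) (by simpa using hS),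
    map_zero]
  intro k hk
  apply h
  intro hk'
  apply hk
  rw [Finset.mem_map]
  exact ⟨_, hk', by simp⟩

/-- `T` vanishes on any family none of whose members has a slot-`k₀` component. -/
theorem TT_eq_zero_of_slot_missing (v : Fin 4 → (PP L Θ).L) (k₀ : Fin 4)
    (h : ∀ k, pr L Θ k₀ (v k) = 0) : TT L Θ ξ v = 0 := by
  refine alternatization_eq_zero_of_forall _ _ fun σ => ?_
  rw [Tm_apply, Finset.prod_eq_zero (Finset.mem_univ k₀), map_zero]
  have hk := h (σ k₀)
  fin_cases k₀ <;> (simp at hk; simp [leg, hk])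

/-- `T` on a family in slots `0, 1, 2, 3`. -/
theorem TT_apply_sorted (x : Fin 4 → FK L) :
    TT L Θ ξ (fun k => emb L Θ k (x k))
      = Algebra.trace ℚ (FK L) (eK L (ξ 2 * ξ 3) * x 0 * x 1 * cF L (x 2) * cF L (x 3)) := by
  rw [TT, alternatization_apply_of_ne_one]
  · rw [Tm_apply, Fin.prod_univ_four]
    simp [leg, mul_assoc]
  · intro σ hσ
    obtain ⟨k, hk⟩ : ∃ k, σ k ≠ k := by
      by_contra hne
      push Not at hne
      exact hσ (Equiv.ext fun k => by simpa using hne k)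
    rw [Tm_apply, Finset.prod_eq_zero (Finset.mem_univ k), map_zero]
    have hz : pr L Θ k (emb L Θ (σ k) (x (σ k))) = 0 := pr_emb_of_ne L Θ hk _
    fin_cases k <;> (simp at hz; simp [leg, hz])


-- port_pkg: scope closed for this part
end Block
end
end HodgeCM.ToyG2
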